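import Summits.BirchSwinnertonDyer.BirchSwinnertonDyer.Theorems.GenusKolyvaginAtTwoKramerParityBridgeLocal
import Literature.NumberTheory.GaloisCohomology.PoitouTateSelmerStructuresCanonicalLift
import HarnessLib

/-!
# Route `GenusKolyvaginAtTwo`, crux #2 `GenusPrimitiveSupplyAtTwo` (stmt-BirchSwinnertonDyer-22136):
# KRAMER PARITY VIA QUADRATIC SELMER STRUCTURES, part 2 — counting `#𝓚_v² = #H¹(K_v, E[n])` at every place, inverse
# intertwining maps, and the rigidity `inv_v = can_v` of level-`2` invariant maps

Width seat `bsd-line-gk2-p4` g11 (cell `bsd-f1-sign2`); sequel of `…KramerParityBridgeLocal`. THEOREMS ONLY (no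
definition, no named fact, no `sorry`); helper `--supports stmt-BirchSwinnertonDyer-22136`; no item is closed; BSD is not
proved by any of this.

* `invWeilPairing_flip_bijective` / `natCard_kummerSelmerStructure_mul_self` — at EVERY place of a number field the right
  adjoint of `inv_v(· ∪ₑ ·)` on `H¹(K_v, E[n])` is bijective and `#𝓚_v · #𝓚_v = #H¹(K_v, E[n])` (`n` a prime power; Tate's
  local Euler characteristic at the finite places, Milne I Rem. 3.7 at the real ones, `H¹ = 0` at the complex ones);
* `exists_inverse_of_bijective` — a bijective continuous intertwining map of discrete Galois modules has an inverse;
* `localInvariants_apply_eq_canonical_two`, `invWeilPairing_eq_canonical_two` — **at level `2` every Poitou–Tate family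
  (perfect at the finite places, injective at the real places) coincides with THE canonical invariant maps
  `LocalInvariants.canonical K 2`** at the finite and real places (a hom into `ℤ/2` is determined by its kernel), hence the
  local Weil–Tate pairings on `H¹(K_v, E[2])` are the same for both families at every place.

References: [MilneADT2006] I Ex. 1.6 (c), Cor. 2.3, Thm. 2.8, Thm. 2.13, Rem. 3.7, Cor. 3.4; [CasselsFrohlichANT1967]
Ch. VI §1.1; [PoonenRains2012] Prop. 4.10; [SilvermanAEC2009] III.8.1.
-/

set_option linter.dupNamespace false -- tree convention: `Summit.BirchSwinnertonDyer.BirchSwinnertonDyer.Theorems` (summit = sub-problem)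
set_option autoImplicit false

noncomputable section

open scoped Classical ContRepresentation

namespace Summit.BirchSwinnertonDyer.BirchSwinnertonDyer.Theorems.GenusKolyKramer

open WeierstrassCurve Field NumberField IsDedekindDomain Function Module
open Literature.NumberTheory.EllipticCurves Literature.NumberTheory.GaloisRepresentations
open Literature.NumberTheory.GaloisRepresentations.DiscreteGaloisModule (SelmerStructure mu MuCarrier localTatePairingZMod tateDual)
open Literature.NumberTheory.GaloisCohomology
open Literature.LinearAlgebra.QuadraticForm
open Summit.BirchSwinnertonDyer.Rank1Residual
open Summit.BirchSwinnertonDyer.Rank1Residual.X11b.FiniteDuality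
open Summit.BirchSwinnertonDyer.Rank1Residual.X11b.Relaxation
open Summit.BirchSwinnertonDyer.Rank1Residual.X11b.LocBridge

/-! ## Counting at every place: `#𝓚_v² = #H¹(K_v, E[n])` -/

section Counting

variable {K : Type} [Field K] [NumberField K] (W : WeierstrassCurve K) [W.IsElliptic] (n : ℕ) [NeZero n]
variable (e : geomTorsion W n → geomTorsion W n → AlgebraicClosure K)
  (hμ : ∀ S T, e S T ^ n = 1)
  (hadd₁ : ∀ S₁ S₂ T, e (S₁ + S₂) T = e S₁ T * e S₂ T)
  (hadd₂ : ∀ S T₁ T₂, e S (T₁ + T₂) = e S T₁ * e S T₂)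
  (hgal : ∀ (σ : absoluteGaloisGroup K) (S T : geomTorsion W n), σ • e S T = e (σ • S) (σ • T))
  (halt : ∀ T, e T T = 1) (hnondeg : ∀ T, (∀ S, e S T = 1) → T = 0)
  (inv : LocalInvariants K n)

include halt hnondeg in
/-- **The right adjoint of `inv_v(· ∪ₑ ·)` is bijective at EVERY place** (finite: X11b `KummerPT.invWeilPairing_flip_bijective`;
real: archimedean duality; complex: `H¹ = 0`). [cite: MilneADT2006, Ch. I, Cor. 2.3 and Thm. 2.13 (a)] -/
theorem invWeilPairing_flip_bijective (hperf : inv.IsPerfect) (hreal : inv.InjectiveAtRealPlaces) (v : Place K) :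
    Bijective (invWeilPairing W n e hμ hadd₁ hadd₂ hgal inv v).flip := by
  haveI := finite_geomTorsion_of_neZero W n
  rcases v with w | v
  · rcases w.isReal_or_isComplex with hw | hw
    · exact (bijective_weilCupProduct_infinitePlace W n e hμ hadd₁ hadd₂ w hgal halt hnondeg (inv (Sum.inl w))
        (hreal w hw) (invWeilPairing W n e hμ hadd₁ hadd₂ hgal inv (Sum.inl w))
        (fun x y => invWeilPairing_apply W n e hμ hadd₁ hadd₂ hgal inv (Sum.inl w) x y)).2
    · haveI := subsingleton_galoisCohomology_toLocal_inl_of_isComplex (W.torsionGaloisModule n) hw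
      refine ⟨fun x y _ => Subsingleton.elim x y, fun f => ⟨0, ?_⟩⟩
      ext x
      rw [Subsingleton.elim x 0, map_zero, map_zero]
  · exact X11b.KummerPT.invWeilPairing_flip_bijective W n e hμ hadd₁ hadd₂ hgal hnondeg inv v (hperf v).1.1

include e hμ hadd₁ hadd₂ hgal halt hnondeg in
/-- **`#𝓚_v · #𝓚_v = #H¹(K_v, E[n])` at EVERY place** (`n` a prime power): the local Kummer condition is its own
annihilator (§1) and `#𝓛^⊥ · #𝓛 = #H¹` for a pairing with bijective right adjoint (X11b `natCard_annRight_mul`).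
Tate's local Euler characteristic at the finite places; Milne I Rem. 3.7 at the real ones.
[cite: MilneADT2006, Ch. I, Thm. 2.8, Cor. 3.4, Thm. 2.13 and Rem. 3.7] -/
theorem natCard_kummerSelmerStructure_mul_self (hn : IsPrimePow n) (hperf : inv.IsPerfect)
    (hEP : ∀ v : HeightOneSpectrum (𝓞 K), localEulerPoincareCharacteristic (v.adicCompletion K))
    (hreal : inv.InjectiveAtRealPlaces) (v : Place K) :
    Nat.card (W.kummerSelmerStructure n v) * Nat.card (W.kummerSelmerStructure n v) =
      Nat.card (galoisCohomology ((W.torsionGaloisModule n).toLocal v) 1) := by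
  haveI := finite_geomTorsion_of_neZero W n
  haveI := finite_galoisCohomology_toLocal W n v
  have h := natCard_annRight_mul (X11b.KummerPT.nsmul_galoisCohomology_toLocal_eq_zero W n v)
    (invWeilPairing W n e hμ hadd₁ hadd₂ hgal inv v)
    (invWeilPairing_flip_bijective W n e hμ hadd₁ hadd₂ hgal halt hnondeg inv hperf hreal v)
    (W.kummerSelmerStructure n v)
  rwa [annRight_invWeilPairing_kummerSelmerStructure_eq W n e hμ hadd₁ hadd₂ hgal halt hnondeg inv hn hperf hEP
    hreal v] at h

end Counting

section Inverse

variable {K : Type} [Field K] [NumberField K] {M₁ M₂ : Type}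
  [AddCommGroup M₁] [TopologicalSpace M₁] [DiscreteTopology M₁]
  [AddCommGroup M₂] [TopologicalSpace M₂] [DiscreteTopology M₂]
  {ρ₁ : DiscreteGaloisModule K M₁} {ρ₂ : DiscreteGaloisModule K M₂}

omit [NumberField K] in
/-- **A bijective continuous intertwining map of discrete Galois modules has an inverse intertwining map.**
[folklore] -/
theorem exists_inverse_of_bijective (φ : ρ₁.toContRepresentation →ⁱL ρ₂.toContRepresentation)
    (hφ : Bijective φ) :
    ∃ ψ : ρ₂.toContRepresentation →ⁱL ρ₁.toContRepresentation, (∀ a, ψ (φ a) = a) ∧ ∀ b, φ (ψ b) = b := by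
  let E : M₁ ≃+ M₂ := AddEquiv.ofBijective φ.toContinuousLinearMap.toLinearMap.toAddMonoidHom hφ
  have hE : ∀ a, E a = φ a := fun a => rfl
  refine ⟨{ toContinuousLinearMap := ⟨E.symm.toAddMonoidHom.toIntLinearMap, continuous_of_discreteTopology⟩
            isIntertwining' := fun σ => ?_ }, fun a => E.symm_apply_apply a, fun b => ?_⟩
  · refine ContinuousLinearMap.ext fun y => ?_
    change E.symm (ρ₂.toContRepresentation σ y) = ρ₁.toContRepresentation σ (E.symm y)
    apply E.injective
    rw [E.apply_symm_apply, hE, φ.isIntertwining σ (E.symm y), ← hE, E.apply_symm_apply]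
  · exact E.apply_symm_apply b

end Inverse

/-! ## Rigidity of level-`2` invariant maps: `inv_v = can_v` -/

section Canonical

variable {K : Type} [Field K] [NumberField K]

/-- In `ℤ/2` two elements with the same vanishing condition are equal. [folklore] -/
theorem zmod_two_eq_of_eq_zero_iff {a b : ZMod 2} (h : a = 0 ↔ b = 0) : a = b := by
  have key : ∀ z : ZMod 2, z ≠ 0 → z = 1 := by
    intro z hz
    fin_cases z
    · exact absurd rfl hz
    · rfl
  by_cases ha : a = 0
  · rw [ha, h.mp ha]
  · rw [key a ha, key b fun hb => ha (h.mpr hb)]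

/-- **At level `2` a Poitou–Tate family IS the canonical family at the finite and the real places**: at a finite place
`inv_v = a · can_v` with `a` a unit of `ℤ/2`, i.e. `a = 1` (Milne I Cor. 2.3; tree `apply_eq_zero_iff_canonical_inr`); at a
real place both are injective on the `2`-group `H²(K_w, μ₂)` (Milne I Ex. 1.6 (c); `apply_eq_zero_iff_canonical_inl`).
[cite: MilneADT2006, Ch. I, Ex. 1.6 (c) and Cor. 2.3] -/
theorem localInvariants_apply_eq_canonical_two (inv : LocalInvariants K 2) (hperf : inv.IsPerfect)
    (hreal : inv.InjectiveAtRealPlaces) (v : Place K) (hv : ∀ w : InfinitePlace K, v = Sum.inl w → w.IsReal)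
    (c : galoisCohomology ((mu K 2).toLocal v) 2) : inv v c = LocalInvariants.canonical K 2 v c := by
  rcases v with w | v
  · exact zmod_two_eq_of_eq_zero_iff (LocalInvariants.apply_eq_zero_iff_canonical_inl inv hreal (hv w rfl) c)
  · exact zmod_two_eq_of_eq_zero_iff (LocalInvariants.apply_eq_zero_iff_canonical_inr inv hperf v c)

variable (W : WeierstrassCurve K) [W.IsElliptic]
variable (e : geomTorsion W ((2 : ℕ) : ℤ) → geomTorsion W ((2 : ℕ) : ℤ) → AlgebraicClosure K)
  (hμ : ∀ S T, e S T ^ 2 = 1)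
  (hadd₁ : ∀ S₁ S₂ T, e (S₁ + S₂) T = e S₁ T * e S₂ T)
  (hadd₂ : ∀ S T₁ T₂, e S (T₁ + T₂) = e S T₁ * e S T₂)
  (hgal : ∀ (σ : absoluteGaloisGroup K) (S T : geomTorsion W ((2 : ℕ) : ℤ)), σ • e S T = e (σ • S) (σ • T))

omit [W.IsElliptic] in
/-- **The local Weil–Tate pairings `inv_v(· ∪ₑ ·)` at level `2` do not depend on the Poitou–Tate family**: they agree
with those of the canonical family at EVERY place (complex places: `H¹(K_w, E[2]) = 0`).
[cite: MilneADT2006, Ch. I, Ex. 1.6 (c) and Cor. 2.3] -/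
theorem invWeilPairing_eq_canonical_two (inv : LocalInvariants K 2) (hperf : inv.IsPerfect)
    (hreal : inv.InjectiveAtRealPlaces) (v : Place K)
    (x y : galoisCohomology ((W.torsionGaloisModule ((2 : ℕ) : ℤ)).toLocal v) 1) :
    invWeilPairing W 2 e hμ hadd₁ hadd₂ hgal inv v x y =
      invWeilPairing W 2 e hμ hadd₁ hadd₂ hgal (LocalInvariants.canonical K 2) v x y := by
  rcases v with w | v
  · rcases w.isReal_or_isComplex with hw | hw
    · rw [invWeilPairing_apply, invWeilPairing_apply]
      exact localInvariants_apply_eq_canonical_two inv hperf hreal (Sum.inl w)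
        (fun w' h => by cases h; exact hw) _
    · haveI := subsingleton_galoisCohomology_toLocal_inl_of_isComplex (W.torsionGaloisModule ((2 : ℕ) : ℤ)) hw
      rw [Subsingleton.elim x 0]
      simp only [map_zero, AddMonoidHom.zero_apply]
  · rw [invWeilPairing_apply, invWeilPairing_apply]
    exact localInvariants_apply_eq_canonical_two inv hperf hreal (Sum.inr v) (fun w h => by cases h) _

end Canonical
end Summit.BirchSwinnertonDyer.BirchSwinnertonDyer.Theorems.GenusKolyKramer

end
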